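import Literature.NumberTheory.Automorphic.ArchGardingWhittaker
import HarnessLib

/-!
# `τ(g)` commutes with `τ(X)` on Gårding vectors when `g` commutes with `exp(tX)`

Topic `NumberTheory/Automorphic`; namespace `Literature.NumberTheory.Automorphic`. Two small theorems on
the infinitesimal action `archDerivE` (`ArchGardingWhittaker`) of a strongly continuous representation `τ`
of `GL_n(K_∞)`: for a Gårding vector `v` and `g` commuting with the one-parameter subgroup `exp(tX)`,
`τ(g) τ(X) v = τ(X) τ(g) v` (`apply_archDerivE_of_commute`: both sides are the derivative at `t = 0`
of `τ(g exp(tX)) v = τ(exp(tX) g) v`), and the word version `apply_archWordDerivE_of_commute`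
(e.g. `g` central, or any `g` in rank one). Getz–Hahn (2024), §4.2. No definition, no named fact.

## References

* J. R. Getz, H. Hahn, *An Introduction to Automorphic Representations* (2024), §4.2, Def. 4.1,
  Prop. 4.2.3 [GetzHahn2024].
-/

noncomputable section

open MeasureTheory Measure NumberField NumberField.mixedEmbedding IsDedekindDomain Set Filter
open scoped MatrixGroups ENNReal NNReal Classical Topology

namespace Literature.NumberTheory.Automorphic

variable {n : ℕ} {K : Type} [Field K] [NumberField K]

attribute [local instance] glInfBorel borelSpace_glInf locallyCompactSpace_glInf secondCountableTopology_glInf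

-- as in `ArchGardingWhittaker`
set_option backward.isDefEq.respectTransparency false

section Commute

variable {hcpt : isCompact_glFiniteIntegralLevel n K}
  {E : Type*} [NormedAddCommGroup E] [NormedSpace ℂ E] [CompleteSpace E]
  {τ : ContRepresentation ℂ (AutomorphyDatum.gl n K hcpt).arch.carrier E}

/-- **`τ(g) τ(X) v = τ(X) τ(g) v`** for a Gårding vector `v` when `g` commutes with the one-parameter
subgroup `exp(tX)` (both sides are the derivative at `t = 0` of `τ(g exp(tX)) v = τ(exp(tX) g) v`).
[folklore] -/
theorem apply_archDerivE_of_commute (hτ : τ.IsStronglyContinuous) {g : GL (Fin n) (mixedSpace K)}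
    {X : Matrix (Fin n) (Fin n) (mixedSpace K)} (hg : ∀ t : ℝ, g * expGL (t • X) = expGL (t • X) * g)
    {v : E} (hv : v ∈ archGardingSpace hcpt τ) :
    τ (toArch hcpt g) (archDerivE hcpt τ X v) = archDerivE hcpt τ X (τ (toArch hcpt g) v) := by
  have h1 : HasDerivAt (fun t : ℝ => τ (toArch hcpt (expGL (t • X))) (τ (toArch hcpt g) v))
      (archDerivE hcpt τ X (τ (toArch hcpt g) v)) 0 :=
    hasDerivAt_apply_expGL_of_mem_archGardingSpace hτ (apply_mem_archGardingSpace hτ _ hv) X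
  have h2 : HasDerivAt (fun t : ℝ => τ (toArch hcpt g) (τ (toArch hcpt (expGL (t • X))) v))
      (τ (toArch hcpt g) (archDerivE hcpt τ X v)) 0 :=
    ((τ (toArch hcpt g)).restrictScalars ℝ).hasFDerivAt.comp_hasDerivAt (0 : ℝ)
      (hasDerivAt_apply_expGL_of_mem_archGardingSpace hτ hv X)
  have hfun : (fun t : ℝ => τ (toArch hcpt g) (τ (toArch hcpt (expGL (t • X))) v)) =
      fun t : ℝ => τ (toArch hcpt (expGL (t • X))) (τ (toArch hcpt g) v) := by
    funext t
    rw [← mul_apply_eq_comp, ← map_mul, ← mul_apply_eq_comp, ← map_mul]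
    congr 2
    exact Subtype.ext (hg t)
  rw [hfun] at h2
  exact h2.unique h1 |>.symm ▸ rfl

/-- Word version: `τ(g) τ(w) v = τ(w) τ(g) v` when `g` commutes with every `exp(tX)`. [folklore] -/
theorem apply_archWordDerivE_of_commute (hτ : τ.IsStronglyContinuous) {g : GL (Fin n) (mixedSpace K)}
    (hg : ∀ (X : Matrix (Fin n) (Fin n) (mixedSpace K)) (t : ℝ), g * expGL (t • X) = expGL (t • X) * g)
    {v : E} (hv : v ∈ archGardingSpace hcpt τ) :
    ∀ w : List (Matrix (Fin n) (Fin n) (mixedSpace K)),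
      τ (toArch hcpt g) (archWordDerivE hcpt τ w v) = archWordDerivE hcpt τ w (τ (toArch hcpt g) v)
  | [] => rfl
  | X :: w => by
    rw [archWordDerivE_cons, archWordDerivE_cons,
      apply_archDerivE_of_commute hτ (hg X) (archWordDerivE_mem_archGardingSpace hτ w hv),
      apply_archWordDerivE_of_commute hτ hg hv w]

end Commute

end Literature.NumberTheory.Automorphic
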